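import Literature.NumberTheory.Irrationality.Fischler2002.RhinViolaGroupsGeneral
import HarnessLib

/-!
# Fischler 2002, Proposition 3.1 — the group `⟨σ, ψ, χ⟩`, I: algebra of the generators (proofs only)

Topic `Literature/NumberTheory/Irrationality/Fischler2002`. PROOFS ONLY — no new definition, no new statement:
this file and its sequels (`RhinViolaGroup32CardProofs`, `JnLastExponentProofs`, `Prop31Proofs`) DISCHARGE the
named fact `prop31` of `RhinViolaGroupsGeneral.lean`:

> [Fischler2002Polyzetas, §3 Proposition 3.1] « Si `n ≥ 3`, la famille `(𝒥(p))` admet un groupe de Rhin-Viola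
> d'ordre 32, isomorphe à `(D₂ × D₂) ⋊ ℤ/2ℤ`, qui est engendré par `σ`, `ψ` et `χ`. »
> (= [Fischler2003RhinViola, §4.3 Théorème 8 p. 524]; read on the page, `paper:arxiv-math_0202064` p. 4.)

The note prints no proof; the structure `(D₂ × D₂) ⋊ ℤ/2ℤ` is made explicit here on the typed maps `sigma`,
`psi n`, `chi n` (acting on the record `Exponents`, all coordinates outside the printed ones fixed):

* `Prop31.psi_psi` — `ψ` is an involution for every `n ≥ 2` (index bookkeeping of the printed formula for `ψ`).
* `Prop31.psi_chi_psi_eq` — CLOSED FORM of `χ' := ψχψ` (`n ≥ 3`): `a₁ ↦ a₂ + b₂ − b₁`, `b₂ ↦ a₁ − a₂ + b₁`, all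
  other coordinates fixed ("`χ` at the other end of the chain").
* `Prop31.psi_sigma_psi_eq` — CLOSED FORM of `σ' := ψσψ` (`n ≥ 3`; `D = b_n − c_n`): `a_n ↔ b_n`,
  `c_n ↦ a_n + D`, `a_{n−1} ↦ a_{n−1} + D`, and `c_{n−2} ↦ c_{n−2} − D` if `n ≥ 4`, resp. `b₁ ↦ b₁ + D` if `n = 3`.
* the four COMMUTATION RELATIONS `σχ = χσ`, `σχ' = χ'σ`, `χχ' = χ'χ`, `σσ' = σ'σ` (and `χσ' = σ'χ`), on maps and
  on any permutations `gσ, gψ, gχ : Equiv.Perm Exponents` with these underlying maps (`prop31` quantifies over such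
  permutations existentially; they exist because the maps are involutions — `sigma_sigma`, `chi_chi` of the
  statement file and `psi_psi` here).

Consequently `N = ⟨σ, χ'⟩ · ⟨χ, σ'⟩` is generated by four pairwise commuting involutions, `σψ = ψσ'`, `χψ = ψχ'`,
and `⟨σ, ψ, χ⟩ = N ∪ ψN` — the 32 words `ψ^e σ^α χ'^β χ^γ σ'^δ`, counted in the sequel. Every identity of this file
was first checked by exact integer arithmetic for `n = 3, …, 9` (cell pub-zeta5, `HOME/pub-zeta5-p1/g44/
group32_check.py`); the Lean proofs are uniform in `n` (`split_ifs` + `grind` on the index conditions).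

HONEST FRAMING (cell pub-zeta5): systematic search; no irrationality claim unless certified — pure bookkeeping of a
printed group structure; nothing about `ζ(5)`.
-/

namespace Literature.NumberTheory.Irrationality.Fischler2002

namespace Prop31

/-! ### `ψ` is an involution -/

/-- `ψ` is an involution of `ℤ^{3n−1}` (on the typed record `Exponents`, all other coordinates fixed), for every
`n ≥ 2`. [cite: Fischler2002Polyzetas, §3 p. 3 (ψ « automorphisme »)] -/
theorem psi_psi {n : ℕ} (hn : 2 ≤ n) (p : Exponents) : psi n (psi n p) = p := by
  cases p with
  | mk a b c =>
  simp only [psi, Exponents.mk.injEq]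
  refine ⟨?_, ?_, ?_⟩
  · funext k
    split_ifs with h1 h2 <;> first | (congr 1; omega) | omega
  · funext k
    split_ifs <;> first | omega | rfl | skip
    · -- k = 1
      subst_vars
      have e1 : n + 1 - (n - 1) = 2 := by omega
      have e2 : n + 2 - n = 2 := by omega
      simp only [e1, e2]; ring
    · congr 1; omega
  · funext k
    split_ifs <;> first | omega | rfl | skip
    · -- 2 ≤ k ≤ n-1
      have e1 : n + 1 - (n + 2 - k) = k - 1 := by omega
      have e2 : n + 2 - (n + 2 - k) = k := by omega
      have e3 : n + 2 - (n + 1 - k) = k + 1 := by omega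
      have e4 : n + 1 - (n + 1 - k) = k := by omega
      have e5 : n - (n + 1 - k) = k - 1 := by omega
      have e6 : n + 1 - (n - k) = k + 1 := by omega
      simp only [e1, e2, e3, e4, e5, e6]; ring
    · -- k = n
      rename_i hk
      have e1 : n + 1 - 2 = n - 1 := by omega
      have e2 : n + 2 - 2 = n := by omega
      have e3 : k = n := by omega
      simp only [e1, e2, e3]; ring

/-- `χ ∘ ψ = ψ ∘ χ'` with `χ'` in closed form (one `ψ`-layer on each side; used to derive the closed form of
`χ' = ψχψ`). [cite: Fischler2002Polyzetas, §3 p. 3–4 (σ, ψ, χ and Proposition 3.1)] -/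
theorem chi_psi_eq {n : ℕ} (hn : 3 ≤ n) (p : Exponents) :
    chi n (psi n p) =
      psi n ⟨fun k => if k = 1 then p.a 2 + p.b 2 - p.b 1 else p.a k,
        fun k => if k = 2 then p.a 1 - p.a 2 + p.b 1 else p.b k, p.c⟩ := by
  cases p with
  | mk a b c =>
  simp only [psi, chi, Exponents.mk.injEq]
  refine ⟨?_, ?_, ?_⟩
  · funext k
    split_ifs <;> grind
  · funext k
    split_ifs <;> grind
  · funext k
    split_ifs <;> grind

/-- **Closed form of `χ' := ψχψ`** (`n ≥ 3`): `χ'` replaces `a₁` by `a₂ + b₂ − b₁` and `b₂` by `a₁ − a₂ + b₁` and fixes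
every other coordinate ("`χ` transported to the other end of the chain by `ψ`").
[cite: Fischler2002Polyzetas, §3 p. 3–4 (σ, ψ, χ and Proposition 3.1)] -/
theorem psi_chi_psi_eq {n : ℕ} (hn : 3 ≤ n) (p : Exponents) :
    psi n (chi n (psi n p)) =
      ⟨fun k => if k = 1 then p.a 2 + p.b 2 - p.b 1 else p.a k,
        fun k => if k = 2 then p.a 1 - p.a 2 + p.b 1 else p.b k, p.c⟩ := by
  rw [chi_psi_eq hn, psi_psi (by omega)]

/-- `σ ∘ ψ = ψ ∘ σ'` with `σ'` in closed form (one `ψ`-layer on each side; used to derive the closed form of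
`σ' = ψσψ`). [cite: Fischler2002Polyzetas, §3 p. 3–4 (σ, ψ, χ and Proposition 3.1)] -/
theorem sigma_psi_eq {n : ℕ} (hn : 3 ≤ n) (p : Exponents) :
    sigma (psi n p) =
      psi n ⟨fun k => if k = n then p.b n else if k = n - 1 then p.a (n - 1) + (p.b n - p.c n) else p.a k,
        fun k => if k = n then p.a n else if n = 3 ∧ k = 1 then p.b 1 + (p.b n - p.c n) else p.b k,
        fun k => if k = n then p.a n + p.b n - p.c n
          else if 4 ≤ n ∧ k = n - 2 then p.c (n - 2) - (p.b n - p.c n) else p.c k⟩ := by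
  cases p with
  | mk a b c =>
  simp only [psi, sigma, Exponents.mk.injEq]
  refine ⟨?_, ?_, ?_⟩
  · funext k
    split_ifs <;> grind
  · funext k
    split_ifs <;> grind
  · funext k
    split_ifs <;> grind

/-- **Closed form of `σ' := ψσψ`** (`n ≥ 3`; `D = b_n − c_n`): `σ'` exchanges `a_n ↔ b_n`, replaces `c_n` by `a_n + D`
and `a_{n−1}` by `a_{n−1} + D`, and in addition `c_{n−2}` by `c_{n−2} − D` when `n ≥ 4`, resp. `b₁` by `b₁ + D` when
`n = 3`; every other coordinate is fixed. [cite: Fischler2002Polyzetas, §3 p. 3–4 (σ, ψ, χ and Proposition 3.1)] -/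
theorem psi_sigma_psi_eq {n : ℕ} (hn : 3 ≤ n) (p : Exponents) :
    psi n (sigma (psi n p)) =
      ⟨fun k => if k = n then p.b n else if k = n - 1 then p.a (n - 1) + (p.b n - p.c n) else p.a k,
        fun k => if k = n then p.a n else if n = 3 ∧ k = 1 then p.b 1 + (p.b n - p.c n) else p.b k,
        fun k => if k = n then p.a n + p.b n - p.c n
          else if 4 ≤ n ∧ k = n - 2 then p.c (n - 2) - (p.b n - p.c n) else p.c k⟩ := by
  rw [sigma_psi_eq hn, psi_psi (by omega)]

/-! ### The four commutation relations behind `N = ⟨σ, χ', χ, σ'⟩ ≅ (ℤ/2)⁴` -/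

/-- `σ` and `χ` commute (`n ≥ 3`: disjoint coordinates). [cite: Fischler2002Polyzetas, §3 Proposition 3.1] -/
theorem sigma_chi_comm {n : ℕ} (hn : 3 ≤ n) (p : Exponents) : sigma (chi n p) = chi n (sigma p) := by
  cases p with
  | mk a b c =>
  simp only [sigma, chi, Exponents.mk.injEq]
  refine ⟨?_, ?_, ?_⟩
  · funext k
    split_ifs <;> grind
  · funext k
    split_ifs <;> grind
  · funext k
    split_ifs <;> grind

/-- `σ` and `χ' = ψχψ` commute (`n ≥ 3`). [cite: Fischler2002Polyzetas, §3 Proposition 3.1] -/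
theorem sigma_chi'_comm {n : ℕ} (hn : 3 ≤ n) (p : Exponents) :
    sigma (psi n (chi n (psi n p))) = psi n (chi n (psi n (sigma p))) := by
  rw [psi_chi_psi_eq hn, psi_chi_psi_eq hn]
  cases p with
  | mk a b c =>
  simp only [sigma, Exponents.mk.injEq]
  refine ⟨?_, ?_, trivial⟩
  · funext k
    split_ifs <;> grind
  · funext k
    split_ifs <;> grind

/-- `χ` and `χ' = ψχψ` commute (`n ≥ 3`). [cite: Fischler2002Polyzetas, §3 Proposition 3.1] -/
theorem chi_chi'_comm {n : ℕ} (hn : 3 ≤ n) (p : Exponents) :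
    chi n (psi n (chi n (psi n p))) = psi n (chi n (psi n (chi n p))) := by
  rw [psi_chi_psi_eq hn, psi_chi_psi_eq hn]
  cases p with
  | mk a b c =>
  simp only [chi, Exponents.mk.injEq]
  refine ⟨?_, ?_, ?_⟩
  · funext k
    split_ifs <;> grind
  · funext k
    split_ifs <;> grind
  · funext k
    split_ifs <;> grind

/-- `σ` and `σ' = ψσψ` commute (`n ≥ 3`; for `n = 3` the two supports meet in `a₂, b₁`, shifted symmetrically).
[cite: Fischler2002Polyzetas, §3 Proposition 3.1] -/
theorem sigma_sigma'_comm {n : ℕ} (hn : 3 ≤ n) (p : Exponents) :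
    sigma (psi n (sigma (psi n p))) = psi n (sigma (psi n (sigma p))) := by
  rw [psi_sigma_psi_eq hn, psi_sigma_psi_eq hn]
  cases p with
  | mk a b c =>
  simp only [sigma, Exponents.mk.injEq]
  refine ⟨?_, ?_, ?_⟩
  · funext k
    split_ifs <;> grind
  · funext k
    split_ifs <;> grind
  · funext k
    split_ifs <;> grind

/-- `χ` and `σ' = ψσψ` commute (`n ≥ 3`). [cite: Fischler2002Polyzetas, §3 Proposition 3.1] -/
theorem chi_sigma'_comm {n : ℕ} (hn : 3 ≤ n) (p : Exponents) :
    chi n (psi n (sigma (psi n p))) = psi n (sigma (psi n (chi n p))) := by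
  rw [psi_sigma_psi_eq hn, psi_sigma_psi_eq hn]
  cases p with
  | mk a b c =>
  simp only [chi, Exponents.mk.injEq]
  refine ⟨?_, ?_, ?_⟩
  · funext k
    split_ifs <;> grind
  · funext k
    split_ifs <;> grind
  · funext k
    split_ifs <;> grind

/-! ### The relations at the level of permutations

Below `gσ gψ gχ : Equiv.Perm Exponents` are ANY permutations whose underlying maps are the typed `sigma`, `psi n`,
`chi n` (such permutations exist since the three maps are involutions; `prop31` quantifies over them existentially). -/

section PermRelations

variable {n : ℕ} {gσ gψ gχ : Equiv.Perm Exponents}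

/-- `σ² = 1`. [cite: Fischler2002Polyzetas, §3 p. 3 (σ « automorphisme »)] -/
theorem perm_sigma_mul_self (hσ : ⇑gσ = sigma) : gσ * gσ = 1 :=
  Equiv.ext fun p => by simp only [Equiv.Perm.mul_apply, Equiv.Perm.one_apply, hσ, sigma_sigma]

/-- `ψ² = 1` (`n ≥ 2`). [cite: Fischler2002Polyzetas, §3 p. 3 (ψ « automorphisme »)] -/
theorem perm_psi_mul_self (hn : 2 ≤ n) (hψ : ⇑gψ = psi n) : gψ * gψ = 1 :=
  Equiv.ext fun p => by simp only [Equiv.Perm.mul_apply, Equiv.Perm.one_apply, hψ, psi_psi hn]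

/-- `χ² = 1`. [cite: Fischler2002Polyzetas, §3 p. 3 (χ « automorphisme »)] -/
theorem perm_chi_mul_self (hχ : ⇑gχ = chi n) : gχ * gχ = 1 :=
  Equiv.ext fun p => by simp only [Equiv.Perm.mul_apply, Equiv.Perm.one_apply, hχ, chi_chi]

/-- `σχ = χσ` (`n ≥ 3`). [cite: Fischler2002Polyzetas, §3 Proposition 3.1] -/
theorem perm_sigma_chi (hn : 3 ≤ n) (hσ : ⇑gσ = sigma) (hχ : ⇑gχ = chi n) : gσ * gχ = gχ * gσ :=
  Equiv.ext fun p => by simp only [Equiv.Perm.mul_apply, hσ, hχ, sigma_chi_comm hn]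

/-- `σχ' = χ'σ` with `χ' = ψχψ` (`n ≥ 3`). [cite: Fischler2002Polyzetas, §3 Proposition 3.1] -/
theorem perm_sigma_chi' (hn : 3 ≤ n) (hσ : ⇑gσ = sigma) (hψ : ⇑gψ = psi n) (hχ : ⇑gχ = chi n) :
    gσ * (gψ * gχ * gψ) = gψ * gχ * gψ * gσ :=
  Equiv.ext fun p => by simp only [Equiv.Perm.mul_apply, hσ, hψ, hχ, sigma_chi'_comm hn]

/-- `χχ' = χ'χ` with `χ' = ψχψ` (`n ≥ 3`). [cite: Fischler2002Polyzetas, §3 Proposition 3.1] -/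
theorem perm_chi_chi' (hn : 3 ≤ n) (hψ : ⇑gψ = psi n) (hχ : ⇑gχ = chi n) :
    gχ * (gψ * gχ * gψ) = gψ * gχ * gψ * gχ :=
  Equiv.ext fun p => by simp only [Equiv.Perm.mul_apply, hψ, hχ, chi_chi'_comm hn]

/-- `σσ' = σ'σ` with `σ' = ψσψ` (`n ≥ 3`). [cite: Fischler2002Polyzetas, §3 Proposition 3.1] -/
theorem perm_sigma_sigma' (hn : 3 ≤ n) (hσ : ⇑gσ = sigma) (hψ : ⇑gψ = psi n) :
    gσ * (gψ * gσ * gψ) = gψ * gσ * gψ * gσ :=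
  Equiv.ext fun p => by simp only [Equiv.Perm.mul_apply, hσ, hψ, sigma_sigma'_comm hn]

/-- `χ'σ' = σ'χ'` with `χ' = ψχψ`, `σ' = ψσψ` (conjugate of `σχ = χσ` by `ψ`).
[cite: Fischler2002Polyzetas, §3 Proposition 3.1] -/
theorem perm_chi'_sigma' (hn : 3 ≤ n) (hσ : ⇑gσ = sigma) (hψ : ⇑gψ = psi n) (hχ : ⇑gχ = chi n) :
    gψ * gχ * gψ * (gψ * gσ * gψ) = gψ * gσ * gψ * (gψ * gχ * gψ) :=
  Equiv.ext fun p => by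
    simp only [Equiv.Perm.mul_apply, hσ, hψ, hχ, psi_psi (show 2 ≤ n by omega), sigma_chi_comm hn]

/-- `χσ' = σ'χ` with `σ' = ψσψ` (`n ≥ 3`). [cite: Fischler2002Polyzetas, §3 Proposition 3.1] -/
theorem perm_chi_sigma' (hn : 3 ≤ n) (hσ : ⇑gσ = sigma) (hψ : ⇑gψ = psi n) (hχ : ⇑gχ = chi n) :
    gχ * (gψ * gσ * gψ) = gψ * gσ * gψ * gχ :=
  Equiv.ext fun p => by simp only [Equiv.Perm.mul_apply, hσ, hψ, hχ, chi_sigma'_comm hn]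

end PermRelations

end Prop31

end Literature.NumberTheory.Irrationality.Fischler2002
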